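import Mathlib
import Summits.ValiantsHypothesis.ValiantsHypothesis.Theorems.PermanentalConesPermanentalHyperbolic
import Literature.AlgebraicGeometry.HyperbolicPolynomials.HyperbolicityCone
import Literature.AlgebraicGeometry.HyperbolicPolynomials.SmoothBoundary

/-!
# `PermanentalConeHard` (stmt-ValiantsHypothesis-8654), line `birth` — the objects of the core stub

Route `PermanentalCones` of `ValiantsHypothesis`, crux `PermanentalConeHard`, core stub
`stub_permanentalGradientPsdRank` (psd-rank lower bound for the GRADIENT SLACK MATRICES
`S[i,k] = gradForm Q_n (z_k) (x_i) = ⟨∇Q_n(z_k), x_i⟩` of the permanental hyperbolicity cones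
`K_n = Λ₊(Q_n, 𝟙)`, `Q_n = per[(Y)_{rows<r}; x^{(n-r)}]`).  Two structural facts every attack on the
core stub uses:

* `eval_rowPermanent` / `gradForm_rowPermanent` — **the slack entries are permanents**: for `r < n`,
  `⟨∇Q_{n,r,Y}(z), x⟩ = (n - r) · per[(Y)_{rows<r}; x; z^{(n-r-1)}]`, i.e. the gradient slack
  operator of `K_n` at `(x, z)` is the NEXT member of the family (one more constant row, `x`)
  evaluated at `z` (Gurvits' polarisation identity `sum_C_mul_pderiv_rowPermanent`, evaluated).
* `mem_hyperbolicityCone_rowPermanent_of_nonneg` — **the orthant lies in the cone**: for entrywise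
  nonnegative `Y` with `Q(𝟙) ≠ 0`, every `x ≥ 0` (in particular every Boolean point `1_S`) lies in
  `Λ₊(Q, 𝟙)` (monotonicity of the permanent of a nonnegative matrix in its entries).

References: L. Gurvits, *Hyperbolic polynomials approach to Van der Waerden/Schrijver–Valiant like
conjectures*, arXiv:math/0510452, §2 (polarisation identity); folklore (monotonicity).
-/

set_option linter.dupNamespace false

noncomputable section

namespace Summit.ValiantsHypothesis.ValiantsHypothesis.Theorems.PermanentalConesPermanentalConeHard

open MvPolynomial Finset
open scoped BigOperators
open Literature.AlgebraicGeometry.HyperbolicPolynomials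

variable {n : ℕ}

/-- Evaluating the permanental polynomial `per[(Y)_{rows<r}; x^{(n-r)}]` at `z` gives the real
permanent `per[(Y)_{rows<r}; z^{(n-r)}]`. [folklore] -/
theorem eval_rowPermanent (Y : Fin n → Fin n → ℝ) (r : ℕ) (z : Fin n → ℝ) :
    MvPolynomial.eval z (Matrix.of fun a b : Fin n =>
        if (a : ℕ) < r then C (Y a b) else (X b : MvPolynomial (Fin n) ℝ)).permanent =
      (Matrix.of fun a b : Fin n => if (a : ℕ) < r then Y a b else z b).permanent := by
  rw [Theorems.ringHom_map_permanent (MvPolynomial.eval z) _]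
  congr 1
  ext a b
  simp only [Matrix.map_apply, Matrix.of_apply]
  split_ifs <;> simp

/-- **The gradient slack entries of a permanental cone are permanents** (Gurvits' polarisation
identity, evaluated): for `r < n` and any `x z : ℝⁿ`,
`⟨∇Q(z), x⟩ = (n - r) · per[(Y)_{rows<r}; x; z^{(n-r-1)}]` where `Q = per[(Y)_{rows<r}; s^{(n-r)}]`.
[cite: Gurvits2008, §2 (polarisation; also arXiv:math/0510452 §2)] -/
theorem gradForm_rowPermanent (Y : Fin n → Fin n → ℝ) {r : ℕ} (hr : r < n) (z x : Fin n → ℝ) :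
    gradForm (Matrix.of fun a b : Fin n =>
        if (a : ℕ) < r then C (Y a b) else (X b : MvPolynomial (Fin n) ℝ)).permanent z x =
      ((n - r : ℕ) : ℝ) * (Matrix.of fun a b : Fin n =>
        if (a : ℕ) < r then Y a b else if (a : ℕ) = r then x b else z b).permanent := by
  classical
  -- the direction `x` as the new constant row `r`
  set Y' : Fin n → Fin n → ℝ := fun a b => if (a : ℕ) = r then x b else Y a b with hY'
  have hrow : (Matrix.of fun a b : Fin n =>
      if (a : ℕ) < r then C (Y' a b) else (X b : MvPolynomial (Fin n) ℝ)) =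
      Matrix.of fun a b : Fin n => if (a : ℕ) < r then C (Y a b) else (X b : MvPolynomial (Fin n) ℝ) := by
    ext a b
    simp only [Matrix.of_apply, hY']
    split_ifs with h1 h2
    · exact absurd h2 (Nat.ne_of_lt h1)
    · rfl
    · rfl
  have hid := Theorems.sum_C_mul_pderiv_rowPermanent (R := ℝ) Y' hr
  rw [hrow] at hid
  have hx : ∀ j, Y' ⟨r, hr⟩ j = x j := fun j => by simp [hY']
  simp only [hx] at hid
  -- evaluate both sides at `z`
  have hev := congrArg (MvPolynomial.eval z) hid
  rw [map_sum, map_sum] at hev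
  simp only [map_mul, eval_C] at hev
  have hL : gradForm (Matrix.of fun a b : Fin n =>
      if (a : ℕ) < r then C (Y a b) else (X b : MvPolynomial (Fin n) ℝ)).permanent z x =
      ∑ j, x j * MvPolynomial.eval z (pderiv j (Matrix.of fun a b : Fin n =>
        if (a : ℕ) < r then C (Y a b) else (X b : MvPolynomial (Fin n) ℝ)).permanent) := rfl
  rw [hL, hev, Finset.sum_const, nsmul_eq_mul]
  congr 1
  · -- the number of variable rows `a ≥ r` is `n - r`
    have hc : (univ.filter fun a : Fin n => r ≤ (a : ℕ)) =
        (univ.filter fun a : Fin n => (a : ℕ) < r)ᶜ := by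
      ext a
      simp [not_lt]
    rw [hc, Finset.card_compl, Fin.card_filter_val_lt, Fintype.card_fin, Nat.min_eq_right hr.le]
  · rw [eval_rowPermanent]
    congr 1
    ext a b
    simp only [Matrix.of_apply, hY']
    by_cases h1 : (a : ℕ) < r
    · have h2 : (a : ℕ) < r + 1 := Nat.lt_succ_of_lt h1
      have h3 : (a : ℕ) ≠ r := Nat.ne_of_lt h1
      simp [h1, h2, h3]
    · by_cases h2 : (a : ℕ) = r
      · simp [h2]
      · have h3 : ¬ (a : ℕ) < r + 1 := by omega
        simp [h1, h2, h3]

/-- The permanent of an entrywise nonnegative real matrix is monotone in the entries. [folklore] -/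
theorem permanent_le_permanent_of_le {m : Type*} [DecidableEq m] [Fintype m]
    {M N : Matrix m m ℝ} (hM : ∀ a b, 0 ≤ M a b) (hMN : ∀ a b, M a b ≤ N a b) :
    M.permanent ≤ N.permanent := by
  unfold Matrix.permanent
  exact Finset.sum_le_sum fun σ _ =>
    Finset.prod_le_prod (fun i _ => hM _ _) (fun i _ => hMN _ _)

/-- The permanent of an entrywise nonnegative real matrix is nonnegative. [folklore] -/
theorem permanent_nonneg {m : Type*} [DecidableEq m] [Fintype m]
    {M : Matrix m m ℝ} (hM : ∀ a b, 0 ≤ M a b) : 0 ≤ M.permanent := by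
  unfold Matrix.permanent
  exact Finset.sum_nonneg fun σ _ => Finset.prod_nonneg fun i _ => hM _ _

/-- The permanental polynomial `per[(Y)_{rows<r}; s^{(n-r)}]` is homogeneous of degree
`#{variable rows}`. [folklore] -/
theorem isHomogeneous_rowPermanent (Y : Fin n → Fin n → ℝ) (r : ℕ) :
    (Matrix.of fun a b : Fin n =>
        if (a : ℕ) < r then C (Y a b) else (X b : MvPolynomial (Fin n) ℝ)).permanent.IsHomogeneous
      (∑ j : Fin n, (if (j : ℕ) < r then 0 else 1)) := by
  classical
  unfold Matrix.permanent
  refine MvPolynomial.IsHomogeneous.sum _ _ _ (fun σ _ => ?_)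
  have hprod := MvPolynomial.IsHomogeneous.prod (Finset.univ : Finset (Fin n))
    (fun i => (Matrix.of fun i j : Fin n =>
      if (i : ℕ) < r then C (Y i j) else (X j : MvPolynomial (Fin n) ℝ)) (σ i) i)
    (fun i => if ((σ i : Fin n) : ℕ) < r then 0 else 1) (fun i _ => ?_)
  · rwa [Equiv.sum_comp σ (fun j : Fin n => if (j : ℕ) < r then (0 : ℕ) else 1)] at hprod
  · simp only [Matrix.of_apply]
    split_ifs
    · exact MvPolynomial.isHomogeneous_C _ _
    · exact MvPolynomial.isHomogeneous_X _ _

/-- **The nonnegative orthant lies in every nonnegative permanental cone**: if `Y ≥ 0` entrywise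
and `Q(𝟙) ≠ 0` for `Q = per[(Y)_{rows<r}; s^{(n-r)}]`, then every `x ≥ 0` (e.g. every Boolean point
`1_S`) lies in the closed hyperbolicity cone `Λ₊(Q, 𝟙)`: `Q(x + τ𝟙) ≥ Q(τ𝟙) = τ^{d} Q(𝟙) > 0`
by monotonicity of nonnegative permanents and homogeneity. [folklore] -/
theorem mem_hyperbolicityCone_rowPermanent_of_nonneg (Y : Fin n → Fin n → ℝ) (r : ℕ)
    (hY : ∀ a b, 0 ≤ Y a b)
    (h1 : MvPolynomial.eval (fun _ => (1 : ℝ)) (Matrix.of fun a b : Fin n =>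
        if (a : ℕ) < r then C (Y a b) else (X b : MvPolynomial (Fin n) ℝ)).permanent ≠ 0)
    {x : Fin n → ℝ} (hx : ∀ j, 0 ≤ x j) :
    x ∈ hyperbolicityCone (Matrix.of fun a b : Fin n =>
        if (a : ℕ) < r then C (Y a b) else (X b : MvPolynomial (Fin n) ℝ)).permanent
      (fun _ => (1 : ℝ)) := by
  classical
  rw [mem_hyperbolicityCone_iff]
  intro τ hτ
  -- `Q(𝟙) > 0`
  have hpos1 : 0 < MvPolynomial.eval (fun _ => (1 : ℝ)) (Matrix.of fun a b : Fin n =>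
      if (a : ℕ) < r then C (Y a b) else (X b : MvPolynomial (Fin n) ℝ)).permanent := by
    refine lt_of_le_of_ne ?_ (Ne.symm h1)
    rw [eval_rowPermanent]
    refine permanent_nonneg fun a b => ?_
    simp only [Matrix.of_apply]
    split_ifs
    · exact hY a b
    · exact zero_le_one
  -- `Q(τ𝟙) = τ^d Q(𝟙) > 0`
  have hposτ : 0 < MvPolynomial.eval (τ • fun _ : Fin n => (1 : ℝ)) (Matrix.of fun a b : Fin n =>
      if (a : ℕ) < r then C (Y a b) else (X b : MvPolynomial (Fin n) ℝ)).permanent := by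
    rw [(isHomogeneous_rowPermanent Y r).eval_smul_eq]
    exact mul_pos (pow_pos hτ _) hpos1
  -- monotonicity: `Q(τ𝟙) ≤ Q(x + τ𝟙)`
  refine (lt_of_lt_of_le hposτ ?_).ne'
  rw [eval_rowPermanent, eval_rowPermanent]
  refine permanent_le_permanent_of_le (fun a b => ?_) (fun a b => ?_)
  · simp only [Matrix.of_apply, Pi.smul_apply, smul_eq_mul, mul_one]
    split_ifs
    · exact hY a b
    · exact hτ.le
  · simp only [Matrix.of_apply, Pi.add_apply, Pi.smul_apply, smul_eq_mul, mul_one]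
    split_ifs
    · exact le_rfl
    · linarith [hx b]

/-- Registered form (`stub_slackEntriesArePermanents`, infrastructure stub of the core
`stub_permanentalGradientPsdRank`): the gradient slack entries of the permanental cones are the
permanents `(n - r) · per[(Y)_{rows<r}; x; z^{(n-r-1)}]`. [cite: Gurvits2008, §2 (polarisation)] -/
theorem stub_slackEntriesArePermanents :
    ∀ (n : ℕ) (Y : Fin n → Fin n → ℝ) (r : ℕ), r < n → ∀ (z x : Fin n → ℝ),
      gradForm (Matrix.of fun a b : Fin n =>
          if (a : ℕ) < r then MvPolynomial.C (Y a b) else (MvPolynomial.X b : MvPolynomial (Fin n) ℝ)).permanent z x =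
        ((n - r : ℕ) : ℝ) * (Matrix.of fun a b : Fin n =>
          if (a : ℕ) < r then Y a b else if (a : ℕ) = r then x b else z b).permanent :=
  fun _ Y _ hr z x => gradForm_rowPermanent Y hr z x

end Summit.ValiantsHypothesis.ValiantsHypothesis.Theorems.PermanentalConesPermanentalConeHard

end
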